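import Mathlib
import HarnessLib
import Summits.HubbardSuperconductivity.HubbardSuperconductivity.Theorems.KLProgrammeH10TwoPointLimitSymbolLineDerivTwo

/-!
# Route `KLProgramme` — engine support, route (L2) symbol layer at ORDER THREE: third LINE derivatives of a sector-multiplier symbol
# `G(φ² + c)·Z` (cutoff PROFILE of the squared denominator × angular/line factor), with `C³` data of the band

Cell `gate-hubbard-kl`, seat p3 (g10); the order-three twin of p4's `…H10TwoPointLimitLineDerivTwo` / `…SymbolLineDerivTwo` (orders `≤ 2`), for the
WEIGHTED torus bounds of the K3 engine (W1 of (E4)ₙ and the weighted lines of `stub_engine_step_norms`, stmt-HubbardSuperconductivity-20437; located risk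
«(b)-Wt@j≥1», cure W1-MIXED: third differences at the ISOTROPIC rates in every direction, KL STATUS 2026-08-27 15:19Z).  For `G, φ, Z ∈ C³` and a profile
`G` supported in `[0, Λ²]` with `|G′| ≤ g₁/Λ²`, `|G″| ≤ g₂/Λ⁴`, `|G‴| ≤ g₃/Λ⁶`:

* §1 `iteratedDeriv_three_comp₃` — `(G∘ψ)‴ = G‴(ψ)ψ′³ + 3G″(ψ)ψ′ψ″ + G′(ψ)ψ‴`; `iteratedDeriv_three_sq_add` — `(φ²+c)‴ = 6φ′φ″ + 2φφ‴`;
* §2 **`abs_iteratedDeriv_three_radialComp_le`** — `A = G(φ² + c)`: `|A‴| ≤ (8g₃+12g₂)|φ′|³/Λ³ + (12g₂+6g₁)|φ′||φ″|/Λ² + 2g₁|φ‴|/Λ`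
  (on the support `|φ| ≤ Λ` absorbs one `φ` per `G`-derivative; off the support everything vanishes, `radialComp_deriv3_eq_zero_of_lt`);
* §3 `iteratedDeriv_three_mul₃` (Leibniz `(AZ)‴ = A‴Z + 3A″Z′ + 3A′Z″ + AZ‴`) and **`abs_iteratedDeriv_three_radialComp_mul_le`** —
  `|f‴| ≤ [A‴-bound]·|Z| + 3[A″-bound]·|Z′| + 3·(2g₁|φ′|/Λ)·|Z″| + g₀|Z‴|` POINTWISE;
* §4 SPACE line `φ(s) = e(q + s•w)` on a normed space with `‖D²e‖ ≤ K₂`, `‖D³e‖ ≤ K₃` (`|φ′| = |De(q+sw)w|`, `|φ″| ≤ K₂‖w‖²`, `|φ‴| ≤ K₃‖w‖³`):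
  **`abs_iteratedDeriv_three_symbol_spaceLine_le`**; §5 TIME line `φ(s) = k₀ + s h₀`: **`abs_iteratedDeriv_three_symbol_timeLine_le`**
  (`|f‴| ≤ (8g₃+12g₂)|h₀|³|z|/Λ³`).

Everything is proved; no definitions, no named facts. [folklore]  (Benfatto–Giuliani–Mastropietro 2006, proof of Lemma 2.2, (2.53)–(2.55): each derivative
costs `γ^{-h}` in the normal direction; along the tangent the third derivative of the running band is only isotropically controlled.)
-/

noncomputable section

namespace Summit.HubbardSuperconductivity.HubbardSuperconductivity.Theorems.TorusFourierL2

set_option linter.dupNamespace false -- summit = problem name (single-conjunct summit), D-0017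

open Filter Topology Literature.Analysis.Calculus

/-! ### §1 Composition of two `C³` functions of one variable -/

/-- `iteratedDeriv 2 χ` is differentiable with derivative `iteratedDeriv 3 χ` (for `χ ∈ C³`). [folklore] -/
theorem hasDerivAt_iteratedDeriv_two_of_contDiff_three {χ : ℝ → ℝ} (hχ : ContDiff ℝ 3 χ) (y : ℝ) :
    HasDerivAt (iteratedDeriv 2 χ) (iteratedDeriv 3 χ y) y := by
  have hd : Differentiable ℝ (iteratedDeriv 2 χ) := hχ.differentiable_iteratedDeriv 2 (by norm_num)
  have h := (hd y).hasDerivAt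
  rwa [← iteratedDeriv_succ] at h

/-- A `C³` function is `C²`. [folklore] -/
theorem contDiff_two_of_three {f : ℝ → ℝ} (hf : ContDiff ℝ 3 f) : ContDiff ℝ 2 f := hf.of_le (by norm_num)

/-- **Third derivative of a composition**: `(G ∘ ψ)‴(s) = G‴(ψ s)ψ′(s)³ + 3G″(ψ s)ψ′(s)ψ″(s) + G′(ψ s)ψ‴(s)`. [folklore] -/
theorem iteratedDeriv_three_comp₃ {G ψ : ℝ → ℝ} (hG : ContDiff ℝ 3 G) (hψ : ContDiff ℝ 3 ψ) (s : ℝ) :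
    iteratedDeriv 3 (fun s => G (ψ s)) s =
      iteratedDeriv 3 G (ψ s) * deriv ψ s ^ 3 + 3 * (iteratedDeriv 2 G (ψ s) * deriv ψ s * iteratedDeriv 2 ψ s) +
        deriv G (ψ s) * iteratedDeriv 3 ψ s := by
  have hG2 := contDiff_two_of_three hG
  have hψ2 := contDiff_two_of_three hψ
  have h3 : (3 : WithTop ℕ∞) ≠ 0 := by norm_num
  rw [iteratedDeriv_succ]
  have h2fun : iteratedDeriv 2 (fun s => G (ψ s)) =
      fun s => iteratedDeriv 2 G (ψ s) * deriv ψ s ^ 2 + deriv G (ψ s) * iteratedDeriv 2 ψ s :=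
    funext fun s => iteratedDeriv_two_comp₂ hG2 hψ2 s
  rw [h2fun]
  have hψ1 : HasDerivAt ψ (deriv ψ s) s := ((hψ.differentiable h3) s).hasDerivAt
  have hA : HasDerivAt (fun s => iteratedDeriv 2 G (ψ s)) (iteratedDeriv 3 G (ψ s) * deriv ψ s) s :=
    (hasDerivAt_iteratedDeriv_two_of_contDiff_three hG (ψ s)).comp s hψ1
  have hB : HasDerivAt (fun s => deriv ψ s ^ 2) (deriv ψ s * iteratedDeriv 2 ψ s + deriv ψ s * iteratedDeriv 2 ψ s) s := by
    have h : HasDerivAt (fun s => deriv ψ s * deriv ψ s) (iteratedDeriv 2 ψ s * deriv ψ s + deriv ψ s * iteratedDeriv 2 ψ s) s :=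
      (hasDerivAt_deriv_of_contDiff_two hψ2 s).mul (hasDerivAt_deriv_of_contDiff_two hψ2 s)
    have e : (fun s => deriv ψ s ^ 2) = fun s => deriv ψ s * deriv ψ s := funext fun s => sq _
    rw [e]
    convert h using 1
    ring
  have hC : HasDerivAt (fun s => deriv G (ψ s)) (iteratedDeriv 2 G (ψ s) * deriv ψ s) s :=
    (hasDerivAt_deriv_of_contDiff_two hG2 (ψ s)).comp s hψ1
  have hD : HasDerivAt (fun s => iteratedDeriv 2 ψ s) (iteratedDeriv 3 ψ s) s := hasDerivAt_iteratedDeriv_two_of_contDiff_three hψ s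
  have h : HasDerivAt (fun s => iteratedDeriv 2 G (ψ s) * deriv ψ s ^ 2 + deriv G (ψ s) * iteratedDeriv 2 ψ s)
      (iteratedDeriv 3 G (ψ s) * deriv ψ s * deriv ψ s ^ 2 +
          iteratedDeriv 2 G (ψ s) * (deriv ψ s * iteratedDeriv 2 ψ s + deriv ψ s * iteratedDeriv 2 ψ s) +
        (iteratedDeriv 2 G (ψ s) * deriv ψ s * iteratedDeriv 2 ψ s + deriv G (ψ s) * iteratedDeriv 3 ψ s)) s :=
    (hA.mul hB).add (hC.mul hD)
  rw [h.deriv]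
  ring

/-- The inner map `ψ = φ² + c` is `C³`. [folklore] -/
theorem contDiff_three_sq_add {φ : ℝ → ℝ} (hφ : ContDiff ℝ 3 φ) (c : ℝ) : ContDiff ℝ 3 fun s => φ s ^ 2 + c :=
  (hφ.pow 2).add contDiff_const

/-- `(φ² + c)‴ = 6φ′φ″ + 2φφ‴`. [folklore] -/
theorem iteratedDeriv_three_sq_add {φ : ℝ → ℝ} (hφ : ContDiff ℝ 3 φ) (c s : ℝ) :
    iteratedDeriv 3 (fun s => φ s ^ 2 + c) s = 6 * deriv φ s * iteratedDeriv 2 φ s + 2 * φ s * iteratedDeriv 3 φ s := by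
  have hφ2 := contDiff_two_of_three hφ
  have h3 : (3 : WithTop ℕ∞) ≠ 0 := by norm_num
  rw [iteratedDeriv_succ]
  have h2fun : iteratedDeriv 2 (fun s => φ s ^ 2 + c) = fun s => 2 * deriv φ s ^ 2 + 2 * φ s * iteratedDeriv 2 φ s :=
    funext fun s => iteratedDeriv_two_sq_add hφ2 c s
  rw [h2fun]
  have hφ1 : HasDerivAt φ (deriv φ s) s := ((hφ.differentiable h3) s).hasDerivAt
  have hB : HasDerivAt (fun s => deriv φ s ^ 2) (deriv φ s * iteratedDeriv 2 φ s + deriv φ s * iteratedDeriv 2 φ s) s := by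
    have h : HasDerivAt (fun s => deriv φ s * deriv φ s) (iteratedDeriv 2 φ s * deriv φ s + deriv φ s * iteratedDeriv 2 φ s) s :=
      (hasDerivAt_deriv_of_contDiff_two hφ2 s).mul (hasDerivAt_deriv_of_contDiff_two hφ2 s)
    have e : (fun s => deriv φ s ^ 2) = fun s => deriv φ s * deriv φ s := funext fun s => sq _
    rw [e]
    convert h using 1
    ring
  have hD : HasDerivAt (fun s => iteratedDeriv 2 φ s) (iteratedDeriv 3 φ s) s := hasDerivAt_iteratedDeriv_two_of_contDiff_three hφ s
  have h : HasDerivAt (fun s => 2 * deriv φ s ^ 2 + 2 * φ s * iteratedDeriv 2 φ s)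
      (2 * (deriv φ s * iteratedDeriv 2 φ s + deriv φ s * iteratedDeriv 2 φ s) +
        (2 * deriv φ s * iteratedDeriv 2 φ s + 2 * φ s * iteratedDeriv 3 φ s)) s :=
    (hB.const_mul 2).add ((hφ1.const_mul 2).mul hD)
  rw [h.deriv]
  ring

/-! ### §2 The radial composition `A(s) = G(φ(s)² + c)` at order three -/

/-- A function vanishing on `(Λ², ∞)` has vanishing third derivative there. [folklore] -/
theorem iteratedDeriv_three_eq_zero_of_vanish {G : ℝ → ℝ} {Λ : ℝ} (hGv : ∀ u, Λ ^ 2 < u → G u = 0) {u : ℝ} (hu : Λ ^ 2 < u) :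
    iteratedDeriv 3 G u = 0 := by
  have hev : G =ᶠ[𝓝 u] fun _ => (0 : ℝ) := by
    filter_upwards [Ioi_mem_nhds hu] with v hv using hGv v hv
  rw [hev.iteratedDeriv_eq, iteratedDeriv_const]
  simp

/-- **The third derivative of the radial composition vanishes off the support**: `Λ² < φ(s)² + c ⇒ A‴(s) = 0`. [folklore] -/
theorem radialComp_deriv3_eq_zero_of_lt {G φ : ℝ → ℝ} (hG : ContDiff ℝ 3 G) (hφ : ContDiff ℝ 3 φ) {Λ : ℝ}
    (hGv : ∀ u, Λ ^ 2 < u → G u = 0) (c : ℝ) {s : ℝ} (hs : Λ ^ 2 < φ s ^ 2 + c) :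
    iteratedDeriv 3 (fun s => G (φ s ^ 2 + c)) s = 0 := by
  obtain ⟨h1, h2⟩ := deriv_eq_zero_of_vanish hGv hs
  have h3 := iteratedDeriv_three_eq_zero_of_vanish hGv hs
  rw [iteratedDeriv_three_comp₃ hG (contDiff_three_sq_add hφ c), h1, h2, h3]
  ring

/-- **Third derivative of the radial composition**:
`|A‴(s)| ≤ (8g₃ + 12g₂)|φ′(s)|³/Λ³ + (12g₂ + 6g₁)|φ′(s)|·|φ″(s)|/Λ² + 2g₁|φ‴(s)|/Λ`
when `|G′| ≤ g₁/Λ²`, `|G″| ≤ g₂/Λ⁴`, `|G‴| ≤ g₃/Λ⁶` and `G` vanishes above `Λ²` (`c ≥ 0`, `Λ > 0`).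
[cite: BenfattoGiulianiMastropietro2006, §2.5 proof of Lemma 2.2 (2.53)–(2.55)] -/
theorem abs_iteratedDeriv_three_radialComp_le {G φ : ℝ → ℝ} (hG : ContDiff ℝ 3 G) (hφ : ContDiff ℝ 3 φ) {Λ g₁ g₂ g₃ : ℝ}
    (hΛ : 0 < Λ) (hg₁ : 0 ≤ g₁) (hg₂ : 0 ≤ g₂) (hg₃ : 0 ≤ g₃) (hG1 : ∀ u, |deriv G u| ≤ g₁ / Λ ^ 2)
    (hG2 : ∀ u, |iteratedDeriv 2 G u| ≤ g₂ / Λ ^ 4) (hG3 : ∀ u, |iteratedDeriv 3 G u| ≤ g₃ / Λ ^ 6)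
    (hGv : ∀ u, Λ ^ 2 < u → G u = 0) {c : ℝ} (hc : 0 ≤ c) (s : ℝ) :
    |iteratedDeriv 3 (fun s => G (φ s ^ 2 + c)) s| ≤
      (8 * g₃ + 12 * g₂) * |deriv φ s| ^ 3 / Λ ^ 3 + (12 * g₂ + 6 * g₁) * (|deriv φ s| * |iteratedDeriv 2 φ s|) / Λ ^ 2 +
        2 * g₁ * |iteratedDeriv 3 φ s| / Λ := by
  by_cases hs : Λ ^ 2 < φ s ^ 2 + c
  · rw [radialComp_deriv3_eq_zero_of_lt hG hφ hGv c hs, abs_zero]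
    positivity
  · push Not at hs
    have hφΛ : |φ s| ≤ Λ := abs_le_of_sq_add_le hc hΛ.le hs
    rw [iteratedDeriv_three_comp₃ hG (contDiff_three_sq_add hφ c), deriv_sq_add (contDiff_two_of_three hφ) c s,
      iteratedDeriv_two_sq_add (contDiff_two_of_three hφ) c s, iteratedDeriv_three_sq_add hφ c s]
    set a := |deriv φ s| with ha
    set b := |iteratedDeriv 2 φ s| with hb
    set d := |iteratedDeriv 3 φ s| with hd
    have ha0 : 0 ≤ a := abs_nonneg _
    have hb0 : 0 ≤ b := abs_nonneg _
    have hd0 : 0 ≤ d := abs_nonneg _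
    have h1 := hG1 (φ s ^ 2 + c)
    have h2 := hG2 (φ s ^ 2 + c)
    have h3 := hG3 (φ s ^ 2 + c)
    have hφ0 := abs_nonneg (φ s)
    -- term 1: `G‴ · (2φφ′)³`
    have hT1 : |iteratedDeriv 3 G (φ s ^ 2 + c) * (2 * φ s * deriv φ s) ^ 3| ≤ 8 * g₃ * a ^ 3 / Λ ^ 3 := by
      rw [abs_mul, abs_pow, abs_mul, abs_mul, abs_two]
      have hin : (2 * |φ s| * a) ^ 3 ≤ (2 * Λ * a) ^ 3 := by
        refine pow_le_pow_left₀ (by positivity) ?_ 3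
        nlinarith
      calc |iteratedDeriv 3 G (φ s ^ 2 + c)| * (2 * |φ s| * a) ^ 3 ≤ g₃ / Λ ^ 6 * (2 * Λ * a) ^ 3 :=
            mul_le_mul h3 hin (by positivity) (by positivity)
        _ = 8 * g₃ * a ^ 3 / Λ ^ 3 := by field_simp; ring
    -- term 2: `3 G″ · (2φφ′) · (2φ′² + 2φφ″)`
    have hT2 : |3 * (iteratedDeriv 2 G (φ s ^ 2 + c) * (2 * φ s * deriv φ s) * (2 * deriv φ s ^ 2 + 2 * φ s * iteratedDeriv 2 φ s))| ≤
        12 * g₂ * a ^ 3 / Λ ^ 3 + 12 * g₂ * (a * b) / Λ ^ 2 := by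
      have hin : |2 * deriv φ s ^ 2 + 2 * φ s * iteratedDeriv 2 φ s| ≤ 2 * a ^ 2 + 2 * Λ * b := by
        calc _ ≤ |2 * deriv φ s ^ 2| + |2 * φ s * iteratedDeriv 2 φ s| := abs_add_le _ _
          _ = 2 * a ^ 2 + 2 * |φ s| * b := by
              rw [abs_of_nonneg (by positivity), abs_mul, abs_mul, abs_two, ha, hb, ← sq_abs]
          _ ≤ 2 * a ^ 2 + 2 * Λ * b := by nlinarith
      have e : |3 * (iteratedDeriv 2 G (φ s ^ 2 + c) * (2 * φ s * deriv φ s) * (2 * deriv φ s ^ 2 + 2 * φ s * iteratedDeriv 2 φ s))| =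
          3 * (|iteratedDeriv 2 G (φ s ^ 2 + c)| * (2 * |φ s| * a) * |2 * deriv φ s ^ 2 + 2 * φ s * iteratedDeriv 2 φ s|) := by
        rw [abs_mul, abs_mul, abs_mul, abs_mul, abs_mul, abs_two, ha, abs_of_pos (by norm_num : (0:ℝ) < 3)]
      rw [e]
      have step : |iteratedDeriv 2 G (φ s ^ 2 + c)| * (2 * |φ s| * a) * |2 * deriv φ s ^ 2 + 2 * φ s * iteratedDeriv 2 φ s| ≤
          (g₂ / Λ ^ 4) * (2 * Λ * a) * (2 * a ^ 2 + 2 * Λ * b) := by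
        refine mul_le_mul (mul_le_mul h2 (by nlinarith) (by positivity) (by positivity)) hin (abs_nonneg _) (by positivity)
      calc 3 * (|iteratedDeriv 2 G (φ s ^ 2 + c)| * (2 * |φ s| * a) * |2 * deriv φ s ^ 2 + 2 * φ s * iteratedDeriv 2 φ s|)
          ≤ 3 * ((g₂ / Λ ^ 4) * (2 * Λ * a) * (2 * a ^ 2 + 2 * Λ * b)) := by linarith
        _ = 12 * g₂ * a ^ 3 / Λ ^ 3 + 12 * g₂ * (a * b) / Λ ^ 2 := by field_simp; ring
    -- term 3: `G′ · (6φ′φ″ + 2φφ‴)`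
    have hT3 : |deriv G (φ s ^ 2 + c) * (6 * deriv φ s * iteratedDeriv 2 φ s + 2 * φ s * iteratedDeriv 3 φ s)| ≤
        6 * g₁ * (a * b) / Λ ^ 2 + 2 * g₁ * d / Λ := by
      rw [abs_mul]
      have hin : |6 * deriv φ s * iteratedDeriv 2 φ s + 2 * φ s * iteratedDeriv 3 φ s| ≤ 6 * (a * b) + 2 * Λ * d := by
        calc _ ≤ |6 * deriv φ s * iteratedDeriv 2 φ s| + |2 * φ s * iteratedDeriv 3 φ s| := abs_add_le _ _
          _ = 6 * (a * b) + 2 * |φ s| * d := by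
              rw [abs_mul, abs_mul, abs_mul, abs_mul, abs_two, ha, hb, hd, abs_of_pos (by norm_num : (0:ℝ) < 6)]
              ring
          _ ≤ 6 * (a * b) + 2 * Λ * d := by nlinarith
      calc |deriv G (φ s ^ 2 + c)| * |6 * deriv φ s * iteratedDeriv 2 φ s + 2 * φ s * iteratedDeriv 3 φ s|
          ≤ (g₁ / Λ ^ 2) * (6 * (a * b) + 2 * Λ * d) := mul_le_mul h1 hin (abs_nonneg _) (by positivity)
        _ = 6 * g₁ * (a * b) / Λ ^ 2 + 2 * g₁ * d / Λ := by field_simp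
    calc _ ≤ |iteratedDeriv 3 G (φ s ^ 2 + c) * (2 * φ s * deriv φ s) ^ 3 +
            3 * (iteratedDeriv 2 G (φ s ^ 2 + c) * (2 * φ s * deriv φ s) * (2 * deriv φ s ^ 2 + 2 * φ s * iteratedDeriv 2 φ s))| +
          |deriv G (φ s ^ 2 + c) * (6 * deriv φ s * iteratedDeriv 2 φ s + 2 * φ s * iteratedDeriv 3 φ s)| := abs_add_le _ _
      _ ≤ |iteratedDeriv 3 G (φ s ^ 2 + c) * (2 * φ s * deriv φ s) ^ 3| +
            |3 * (iteratedDeriv 2 G (φ s ^ 2 + c) * (2 * φ s * deriv φ s) * (2 * deriv φ s ^ 2 + 2 * φ s * iteratedDeriv 2 φ s))| +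
          |deriv G (φ s ^ 2 + c) * (6 * deriv φ s * iteratedDeriv 2 φ s + 2 * φ s * iteratedDeriv 3 φ s)| := by
          gcongr; exact abs_add_le _ _
      _ ≤ 8 * g₃ * a ^ 3 / Λ ^ 3 + (12 * g₂ * a ^ 3 / Λ ^ 3 + 12 * g₂ * (a * b) / Λ ^ 2) +
          (6 * g₁ * (a * b) / Λ ^ 2 + 2 * g₁ * d / Λ) := add_le_add (add_le_add hT1 hT2) hT3
      _ = _ := by ring

/-! ### §3 Times a `C³` line factor `Z` -/

/-- **Leibniz at order three** (`C³` data): `(AZ)‴ = A‴Z + 3A″Z′ + 3A′Z″ + AZ‴`. [folklore] -/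
theorem iteratedDeriv_three_mul₃ {A Z : ℝ → ℝ} (hA : ContDiff ℝ 3 A) (hZ : ContDiff ℝ 3 Z) (s : ℝ) :
    iteratedDeriv 3 (fun s => A s * Z s) s =
      iteratedDeriv 3 A s * Z s + 3 * (iteratedDeriv 2 A s * deriv Z s) + 3 * (deriv A s * iteratedDeriv 2 Z s) +
        A s * iteratedDeriv 3 Z s := by
  have hA2 := contDiff_two_of_three hA
  have hZ2 := contDiff_two_of_three hZ
  have h3 : (3 : WithTop ℕ∞) ≠ 0 := by norm_num
  rw [iteratedDeriv_succ]
  have h2fun : iteratedDeriv 2 (fun s => A s * Z s) =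
      fun s => iteratedDeriv 2 A s * Z s + 2 * (deriv A s * deriv Z s) + A s * iteratedDeriv 2 Z s :=
    funext fun s => iteratedDeriv_two_mul₂ hA2 hZ2 s
  rw [h2fun]
  have hA1 : HasDerivAt A (deriv A s) s := ((hA.differentiable h3) s).hasDerivAt
  have hZ1 : HasDerivAt Z (deriv Z s) s := ((hZ.differentiable h3) s).hasDerivAt
  have hA2' : HasDerivAt (fun s => deriv A s) (iteratedDeriv 2 A s) s := hasDerivAt_deriv_of_contDiff_two hA2 s
  have hZ2' : HasDerivAt (fun s => deriv Z s) (iteratedDeriv 2 Z s) s := hasDerivAt_deriv_of_contDiff_two hZ2 s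
  have hA3 : HasDerivAt (fun s => iteratedDeriv 2 A s) (iteratedDeriv 3 A s) s := hasDerivAt_iteratedDeriv_two_of_contDiff_three hA s
  have hZ3 : HasDerivAt (fun s => iteratedDeriv 2 Z s) (iteratedDeriv 3 Z s) s := hasDerivAt_iteratedDeriv_two_of_contDiff_three hZ s
  have h : HasDerivAt (fun s => iteratedDeriv 2 A s * Z s + 2 * (deriv A s * deriv Z s) + A s * iteratedDeriv 2 Z s)
      (iteratedDeriv 3 A s * Z s + iteratedDeriv 2 A s * deriv Z s + 2 * (iteratedDeriv 2 A s * deriv Z s + deriv A s * iteratedDeriv 2 Z s) +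
        (deriv A s * iteratedDeriv 2 Z s + A s * iteratedDeriv 3 Z s)) s :=
    ((hA3.mul hZ1).add ((hA2'.mul hZ2').const_mul 2)).add (hA1.mul hZ3)
  rw [h.deriv]
  ring

/-- The product of the radial composition with a `C³` factor is `C³`. [folklore] -/
theorem contDiff_three_radialComp_mul {G φ Z : ℝ → ℝ} (hG : ContDiff ℝ 3 G) (hφ : ContDiff ℝ 3 φ) (hZ : ContDiff ℝ 3 Z)
    (c : ℝ) : ContDiff ℝ 3 fun s => G (φ s ^ 2 + c) * Z s :=
  (hG.comp (contDiff_three_sq_add hφ c)).mul hZ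

/-- **The third line derivative of the symbol vanishes off the cutoff support** `{φ² + c ≤ Λ²}`. [folklore] -/
theorem radialComp_mul_deriv3_eq_zero_of_lt {G φ Z : ℝ → ℝ} (hG : ContDiff ℝ 3 G) (hφ : ContDiff ℝ 3 φ) (hZ : ContDiff ℝ 3 Z)
    {Λ : ℝ} (hGv : ∀ u, Λ ^ 2 < u → G u = 0) (c : ℝ) {s : ℝ} (hs : Λ ^ 2 < φ s ^ 2 + c) :
    iteratedDeriv 3 (fun s => G (φ s ^ 2 + c) * Z s) s = 0 := by
  have hG2 := contDiff_two_of_three hG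
  have hφ2 := contDiff_two_of_three hφ
  obtain ⟨h0, h1, h2⟩ := radialComp_eq_zero_of_lt hG2 hφ2 hGv c hs
  have h3 := radialComp_deriv3_eq_zero_of_lt hG hφ hGv c hs
  have hA : ContDiff ℝ 3 (fun s => G (φ s ^ 2 + c)) := hG.comp (contDiff_three_sq_add hφ c)
  rw [iteratedDeriv_three_mul₃ hA hZ s]
  rw [show iteratedDeriv 3 (fun s => G (φ s ^ 2 + c)) s = 0 from h3, show iteratedDeriv 2 (fun s => G (φ s ^ 2 + c)) s = 0 from h2,
    show deriv (fun s => G (φ s ^ 2 + c)) s = 0 from h1, h0]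
  ring

/-- **Order three — the symbol estimate of the weighted route**:
`|f‴(s)| ≤ [(8g₃+12g₂)|φ′|³/Λ³ + (12g₂+6g₁)|φ′||φ″|/Λ² + 2g₁|φ‴|/Λ]·|Z| + 3·[(4g₂+2g₁)φ′²/Λ² + 2g₁|φ″|/Λ]·|Z′| + 3·(2g₁|φ′|/Λ)·|Z″| + g₀|Z‴|`,
pointwise in `s`. [cite: BenfattoGiulianiMastropietro2006, §2.5 proof of Lemma 2.2 (2.53)–(2.55)] -/
theorem abs_iteratedDeriv_three_radialComp_mul_le {G φ Z : ℝ → ℝ} (hG : ContDiff ℝ 3 G) (hφ : ContDiff ℝ 3 φ)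
    (hZ : ContDiff ℝ 3 Z) {Λ g₀ g₁ g₂ g₃ : ℝ} (hΛ : 0 < Λ) (hg₁ : 0 ≤ g₁) (hg₂ : 0 ≤ g₂) (hg₃ : 0 ≤ g₃) (hG0 : ∀ u, |G u| ≤ g₀)
    (hG1 : ∀ u, |deriv G u| ≤ g₁ / Λ ^ 2) (hG2 : ∀ u, |iteratedDeriv 2 G u| ≤ g₂ / Λ ^ 4) (hG3 : ∀ u, |iteratedDeriv 3 G u| ≤ g₃ / Λ ^ 6)
    (hGv : ∀ u, Λ ^ 2 < u → G u = 0) {c : ℝ} (hc : 0 ≤ c) (s : ℝ) :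
    |iteratedDeriv 3 (fun s => G (φ s ^ 2 + c) * Z s) s| ≤
      ((8 * g₃ + 12 * g₂) * |deriv φ s| ^ 3 / Λ ^ 3 + (12 * g₂ + 6 * g₁) * (|deriv φ s| * |iteratedDeriv 2 φ s|) / Λ ^ 2 +
          2 * g₁ * |iteratedDeriv 3 φ s| / Λ) * |Z s| +
        3 * (((4 * g₂ + 2 * g₁) * deriv φ s ^ 2 / Λ ^ 2 + 2 * g₁ * |iteratedDeriv 2 φ s| / Λ) * |deriv Z s|) +
        3 * (2 * g₁ * |deriv φ s| / Λ * |iteratedDeriv 2 Z s|) + g₀ * |iteratedDeriv 3 Z s| := by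
  have hG2c := contDiff_two_of_three hG
  have hφ2 := contDiff_two_of_three hφ
  have hA : ContDiff ℝ 3 (fun s => G (φ s ^ 2 + c)) := hG.comp (contDiff_three_sq_add hφ c)
  rw [iteratedDeriv_three_mul₃ hA hZ s]
  have h3 := abs_iteratedDeriv_three_radialComp_le hG hφ hΛ hg₁ hg₂ hg₃ hG1 hG2 hG3 hGv hc s
  have h2 := abs_iteratedDeriv_two_radialComp_le hG2c hφ2 hΛ hg₁ hg₂ hG1 hG2 hGv hc s
  have h1 := abs_deriv_radialComp_le hG2c hφ2 hΛ hg₁ hG1 hGv hc s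
  have h0 := hG0 (φ s ^ 2 + c)
  calc _ ≤ |iteratedDeriv 3 (fun s => G (φ s ^ 2 + c)) s * Z s + 3 * (iteratedDeriv 2 (fun s => G (φ s ^ 2 + c)) s * deriv Z s) +
            3 * (deriv (fun s => G (φ s ^ 2 + c)) s * iteratedDeriv 2 Z s)| + |G (φ s ^ 2 + c) * iteratedDeriv 3 Z s| :=
          abs_add_le _ _
    _ ≤ |iteratedDeriv 3 (fun s => G (φ s ^ 2 + c)) s * Z s + 3 * (iteratedDeriv 2 (fun s => G (φ s ^ 2 + c)) s * deriv Z s)| +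
          |3 * (deriv (fun s => G (φ s ^ 2 + c)) s * iteratedDeriv 2 Z s)| + |G (φ s ^ 2 + c) * iteratedDeriv 3 Z s| := by
          gcongr; exact abs_add_le _ _
    _ ≤ |iteratedDeriv 3 (fun s => G (φ s ^ 2 + c)) s * Z s| + |3 * (iteratedDeriv 2 (fun s => G (φ s ^ 2 + c)) s * deriv Z s)| +
          |3 * (deriv (fun s => G (φ s ^ 2 + c)) s * iteratedDeriv 2 Z s)| + |G (φ s ^ 2 + c) * iteratedDeriv 3 Z s| := by
          gcongr; exact abs_add_le _ _
    _ = |iteratedDeriv 3 (fun s => G (φ s ^ 2 + c)) s| * |Z s| + 3 * (|iteratedDeriv 2 (fun s => G (φ s ^ 2 + c)) s| * |deriv Z s|) +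
          3 * (|deriv (fun s => G (φ s ^ 2 + c)) s| * |iteratedDeriv 2 Z s|) + |G (φ s ^ 2 + c)| * |iteratedDeriv 3 Z s| := by
          rw [abs_mul, abs_mul, abs_mul, abs_mul, abs_mul, abs_mul]
          norm_num
    _ ≤ _ := by gcongr

/-! ### §4 The SPACE line `φ(s) = e(q + s•w)` with `C³` data -/

section SpaceLine

variable {V : Type*} [NormedAddCommGroup V] [NormedSpace ℝ V]

/-- The restriction to a line is `C³`. [folklore] -/
theorem contDiff_three_line {e : V → ℝ} (he : ContDiff ℝ 3 e) (q w : V) : ContDiff ℝ 3 fun s : ℝ => e (q + s • w) :=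
  contDiff_lineRestriction he q w

/-- **The third derivative along the line** is bounded by `K₃‖w‖³`. [folklore] -/
theorem abs_iteratedDeriv_three_line_le {e : V → ℝ} (he : ContDiff ℝ 3 e) {K₃ : ℝ} (hK₃ : ∀ p, ‖iteratedFDeriv ℝ 3 e p‖ ≤ K₃)
    (q w : V) (s : ℝ) : |iteratedDeriv 3 (fun s : ℝ => e (q + s • w)) s| ≤ K₃ * ‖w‖ ^ 3 := by
  have h := norm_iteratedDeriv_lineRestriction_le_of_le (n := 3) he hK₃ q w s
  rwa [Real.norm_eq_abs] at h

/-- **Third line derivative of a multiplier symbol along a spatial line** (`‖D²e‖ ≤ K₂`, `‖D³e‖ ≤ K₃`, profile `G` at scale `Λ`, `C³` line factor `Z`):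
`|f‴(s)| ≤ [(8g₃+12g₂)|De·w|³/Λ³ + (12g₂+6g₁)|De·w|·K₂‖w‖²/Λ² + 2g₁K₃‖w‖³/Λ]·|Z| + 3[(4g₂+2g₁)(De·w)²/Λ² + 2g₁K₂‖w‖²/Λ]·|Z′|
          + 3·(2g₁|De·w|/Λ)·|Z″| + g₀|Z‴|` at `s`, `De·w = De(q + s•w)w`. [cite: BenfattoGiulianiMastropietro2006, §2.5 proof of Lemma 2.2 (2.53)–(2.55)] -/
theorem abs_iteratedDeriv_three_symbol_spaceLine_le {e : V → ℝ} (he : ContDiff ℝ 3 e) {K₂ K₃ : ℝ}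
    (hK₂ : ∀ p, ‖iteratedFDeriv ℝ 2 e p‖ ≤ K₂) (hK₃ : ∀ p, ‖iteratedFDeriv ℝ 3 e p‖ ≤ K₃) {G Z : ℝ → ℝ} (hG : ContDiff ℝ 3 G)
    (hZ : ContDiff ℝ 3 Z) {Λ g₀ g₁ g₂ g₃ : ℝ} (hΛ : 0 < Λ) (hg₁ : 0 ≤ g₁) (hg₂ : 0 ≤ g₂) (hg₃ : 0 ≤ g₃) (hG0 : ∀ u, |G u| ≤ g₀)
    (hG1 : ∀ u, |deriv G u| ≤ g₁ / Λ ^ 2) (hG2 : ∀ u, |iteratedDeriv 2 G u| ≤ g₂ / Λ ^ 4) (hG3 : ∀ u, |iteratedDeriv 3 G u| ≤ g₃ / Λ ^ 6)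
    (hGv : ∀ u, Λ ^ 2 < u → G u = 0) {c : ℝ} (hc : 0 ≤ c) (q w : V) (s : ℝ) :
    |iteratedDeriv 3 (fun s : ℝ => G (e (q + s • w) ^ 2 + c) * Z s) s| ≤
      ((8 * g₃ + 12 * g₂) * |fderiv ℝ e (q + s • w) w| ^ 3 / Λ ^ 3 +
            (12 * g₂ + 6 * g₁) * (|fderiv ℝ e (q + s • w) w| * (K₂ * ‖w‖ ^ 2)) / Λ ^ 2 + 2 * g₁ * (K₃ * ‖w‖ ^ 3) / Λ) * |Z s| +
        3 * (((4 * g₂ + 2 * g₁) * (fderiv ℝ e (q + s • w) w) ^ 2 / Λ ^ 2 + 2 * g₁ * (K₂ * ‖w‖ ^ 2) / Λ) * |deriv Z s|) +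
        3 * (2 * g₁ * |fderiv ℝ e (q + s • w) w| / Λ * |iteratedDeriv 2 Z s|) + g₀ * |iteratedDeriv 3 Z s| := by
  have he2 : ContDiff ℝ 2 e := he.of_le (by norm_num)
  have hφ : ContDiff ℝ 3 fun s : ℝ => e (q + s • w) := contDiff_three_line he q w
  have h := abs_iteratedDeriv_three_radialComp_mul_le (φ := fun s : ℝ => e (q + s • w)) hG hφ hZ hΛ hg₁ hg₂ hg₃ hG0 hG1 hG2 hG3 hGv hc s
  rw [deriv_line_eq_fderiv he2 q w s] at h
  have hφ2 := abs_iteratedDeriv_two_line_le he2 hK₂ q w s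
  have hφ3 := abs_iteratedDeriv_three_line_le he hK₃ q w s
  have hK20 : 0 ≤ K₂ := le_trans (norm_nonneg _) (hK₂ q)
  have hK30 : 0 ≤ K₃ := le_trans (norm_nonneg _) (hK₃ q)
  have hDe := abs_nonneg (fderiv ℝ e (q + s • w) w)
  refine h.trans ?_
  have hm1 : ((8 * g₃ + 12 * g₂) * |fderiv ℝ e (q + s • w) w| ^ 3 / Λ ^ 3 +
        (12 * g₂ + 6 * g₁) * (|fderiv ℝ e (q + s • w) w| * |iteratedDeriv 2 (fun s : ℝ => e (q + s • w)) s|) / Λ ^ 2 +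
        2 * g₁ * |iteratedDeriv 3 (fun s : ℝ => e (q + s • w)) s| / Λ) * |Z s| ≤
      ((8 * g₃ + 12 * g₂) * |fderiv ℝ e (q + s • w) w| ^ 3 / Λ ^ 3 +
        (12 * g₂ + 6 * g₁) * (|fderiv ℝ e (q + s • w) w| * (K₂ * ‖w‖ ^ 2)) / Λ ^ 2 + 2 * g₁ * (K₃ * ‖w‖ ^ 3) / Λ) * |Z s| := by
    refine mul_le_mul_of_nonneg_right ?_ (abs_nonneg _)
    gcongr
  have hm2 : 3 * (((4 * g₂ + 2 * g₁) * (fderiv ℝ e (q + s • w) w) ^ 2 / Λ ^ 2 +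
        2 * g₁ * |iteratedDeriv 2 (fun s : ℝ => e (q + s • w)) s| / Λ) * |deriv Z s|) ≤
      3 * (((4 * g₂ + 2 * g₁) * (fderiv ℝ e (q + s • w) w) ^ 2 / Λ ^ 2 + 2 * g₁ * (K₂ * ‖w‖ ^ 2) / Λ) * |deriv Z s|) := by
    refine mul_le_mul_of_nonneg_left (mul_le_mul_of_nonneg_right ?_ (abs_nonneg _)) (by norm_num)
    gcongr
  linarith

end SpaceLine

/-! ### §5 The TIME (Matsubara) line `φ(s) = k₀ + s·h₀` -/

/-- **Third derivative along the Matsubara line**: for `f(s) = G((k₀ + s h₀)² + c)·z` (`c ≥ 0`, `z` constant in `k₀`):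
`|f‴(s)| ≤ (8g₃ + 12g₂)|h₀|³|z|/Λ³`. [cite: BenfattoGiulianiMastropietro2006, §2.5 proof of Lemma 2.2 (2.52), (2.56)] -/
theorem abs_iteratedDeriv_three_symbol_timeLine_le {G : ℝ → ℝ} (hG : ContDiff ℝ 3 G) {Λ g₁ g₂ g₃ : ℝ} (hΛ : 0 < Λ)
    (hg₁ : 0 ≤ g₁) (hg₂ : 0 ≤ g₂) (hg₃ : 0 ≤ g₃) (hG1 : ∀ u, |deriv G u| ≤ g₁ / Λ ^ 2) (hG2 : ∀ u, |iteratedDeriv 2 G u| ≤ g₂ / Λ ^ 4)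
    (hG3 : ∀ u, |iteratedDeriv 3 G u| ≤ g₃ / Λ ^ 6) (hGv : ∀ u, Λ ^ 2 < u → G u = 0) {c : ℝ} (hc : 0 ≤ c) (k₀ h₀ z s : ℝ) :
    |iteratedDeriv 3 (fun s : ℝ => G ((k₀ + s * h₀) ^ 2 + c) * z) s| ≤ (8 * g₃ + 12 * g₂) * |h₀| ^ 3 * |z| / Λ ^ 3 := by
  have hφ : ContDiff ℝ 3 fun s : ℝ => k₀ + s * h₀ := contDiff_const.add (contDiff_id.mul contDiff_const)
  have hA : ContDiff ℝ 3 (fun s => G ((k₀ + s * h₀) ^ 2 + c)) := hG.comp (contDiff_three_sq_add hφ c)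
  have hmul : (fun s : ℝ => G ((k₀ + s * h₀) ^ 2 + c) * z) = fun s => z * G ((k₀ + s * h₀) ^ 2 + c) := by
    funext s; ring
  rw [hmul, iteratedDeriv_const_mul z hA.contDiffAt, abs_mul]
  have hd1 : ∀ s, deriv (fun s : ℝ => k₀ + s * h₀) s = h₀ := fun s => by
    have : HasDerivAt (fun s : ℝ => k₀ + s * h₀) (1 * h₀) s := ((hasDerivAt_id s).mul_const h₀).const_add k₀
    rw [this.deriv]; ring
  have hd1f : deriv (fun s : ℝ => k₀ + s * h₀) = fun _ => h₀ := funext hd1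
  have hd2 : ∀ s, iteratedDeriv 2 (fun s : ℝ => k₀ + s * h₀) s = 0 := fun s => by
    rw [iteratedDeriv_succ, iteratedDeriv_one, hd1f, deriv_const]
  have hd3 : ∀ s, iteratedDeriv 3 (fun s : ℝ => k₀ + s * h₀) s = 0 := fun s => by
    rw [iteratedDeriv_succ]
    have : iteratedDeriv 2 (fun s : ℝ => k₀ + s * h₀) = fun _ => 0 := funext hd2
    rw [this, deriv_const]
  have h := abs_iteratedDeriv_three_radialComp_le (φ := fun s : ℝ => k₀ + s * h₀) hG hφ hΛ hg₁ hg₂ hg₃ hG1 hG2 hG3 hGv hc s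
  rw [hd1, hd2, hd3, abs_zero, mul_zero, mul_zero, zero_div, add_zero, mul_zero, zero_div, add_zero] at h
  calc |z| * |iteratedDeriv 3 (fun s => G ((k₀ + s * h₀) ^ 2 + c)) s| ≤ |z| * ((8 * g₃ + 12 * g₂) * |h₀| ^ 3 / Λ ^ 3) :=
        mul_le_mul_of_nonneg_left h (abs_nonneg _)
    _ = _ := by ring

/-- The Matsubara-line symbol is `C³`. [folklore] -/
theorem contDiff_three_symbol_timeLine {G : ℝ → ℝ} (hG : ContDiff ℝ 3 G) (c k₀ h₀ z : ℝ) :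
    ContDiff ℝ 3 fun s : ℝ => G ((k₀ + s * h₀) ^ 2 + c) * z :=
  (hG.comp (contDiff_three_sq_add (contDiff_const.add (contDiff_id.mul contDiff_const)) c)).mul contDiff_const

end Summit.HubbardSuperconductivity.HubbardSuperconductivity.Theorems.TorusFourierL2

end
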